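import Literature.MathematicalPhysics.QuantumFieldTheory.Balaban1983to89.B10Eq44AvgRegularity
import Literature.MathematicalPhysics.QuantumFieldTheory.Balaban1983to89.B10Eq45LatticeSum

/-!
# `Balaban1983to89.B10Eq44Concrete` — T. Bałaban, *Ultraviolet stability of three-dimensional lattice pure gauge
# field theories*, Commun. Math. Phys. **102** (1985) 255–275 [Balaban1985UV3]: the bounds (44), (45) and — v1.1 — (46) p. 267 on
# the interaction terms `𝒫_j(Y_j, U_k)`, DERIVED from (43) and the regularity of `U_k` for the concrete `j`-fold block
# average (43) of [4] on `ℤ³`, in the letters of `B10SectCExpansion.Bound44` / `Bound45` on the model geometry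
# `B10Eq45LatticeSum.latticeGeometry3` (three concrete carriers with bodies + theorems)

statement-level skeleton of published theorems with citation tags; proofs where landed; nothing here is a claim
about the Yang–Mills mass gap

PDF held: `paper:balaban1985-cmp102-uv-stability-3d` (journal page = PDF page + 254); pp. 266–267 (PDF 12–13), p. 267
read from the render `pub-balaban/b2b-balaban-ref1/pages/1985-cmp102-uv-stability-3d/…-p013-x2.png` as an image.
"[4]" = [Balaban1985Averaging] (cell paper B7).

WHAT IS REPRODUCED (mega-formalization `lit-balaban`, HOME `run/shared/lean/pub/lit-balaban/`, Phase-2 proof seat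
`p29` gen 5, unit `lit-balaban-p29`; file 2/2 for SKELETON rows `B10.Eq44` / `B10.Eq45` of reader r07's `ROWS-B10.md`,
whose decls of record are the hypothesis-shaped leaves `B10SectCExpansion.Shape43` ((43)), `Bound44` ((44)),
`Bound45` ((45)) with the certified bookkeeping `bound44_of_shape43`, `bound45_of_bound44` and r07's evaluated lattice
sum `B10Eq45LatticeSum.bound45_latticeGeometry3`; file 1/2 = `B10Eq44AvgRegularity`: the sentence before (44) and
the loop-variable factor `loop44_le`).  THE PRINTED TEXT.  (43) p. 266: *"`Y_j = (y, c₁, …, c_n)`, where `y` represents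
big blocks of `L^jη`-lattice, contained in `Ω_k`, … and `c_i` are bonds in `Ω_k^{(j)}`, `|c_{i,−} − y| <
R(g_j)M₁L^jη`, `𝒫_j(Y_j, U_k) = ⟨𝒫_j(Y_j), B_k(c₁), …, B_k(c_n)⟩`, `n ≥ 2`, `B_k(c) = (1/i) log Ū_k^j(Γ_{y,c₋} ∪ c ∪
Γ_{c₊,y})`, `c ∈ Ω_k^{(j)}`, (43) `|𝒫_j(Y_j)| ≤ O(1) Π_{i=1}^n exp(−κ₁(M₁L^jη)^{−1}|c_{i,−} − y|)`"*; p. 267: *"The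
configuration `U_k` satisfies the following regularity condition on `Ω_k`: `|U_k(∂p) − 1| < 2L²B₃g_{k−1}p(g_{k−1})η²`.
This implies the condition `|Ū_k^j(∂p′) − 1| < 4L²B₃g_{k−1}p(g_{k−1})(L^jη)²` for `p′ ⊂ Ω_k^{(j)}`, and from (43) we get
`|𝒫_j(Y_j, U_k)| ≤ O(1) Π_{i=1}^n exp(−κ₁(M₁L^jη)^{−1}|c_{i,−} − y|) × (L^jη)^{−1}|c_{i,−} − y| 8L²B₃g_{k−1}p(g_{k−1})
(L^jη)²`. (44) By the assumption `n ≥ 2`, summation over all `Y_j` with `y` fixed yields for `g_{k−1}` sufficiently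
small `Σ_{Y_j: y = y₀} |𝒫_j(Y_j, U_k)| ≤ O(1)(O(M₁³)g_{k−1}p(g_{k−1}))²(L^jη)⁴`. (45)"*.
THIS FILE: on r07's model geometry `latticeGeometry3 ℓ tl` of `Ω_k^{(j)} ≅ ℤ³` (spacing `ℓ = L^jη`, `ℓ¹` lattice
distance) and for ANY family of multilinear coefficients `𝒫_j(Y_j)` obeying (43) (`Shape43`, HYPOTHESIS as printed —
nothing of the expansion producing them is used), the evaluated terms `⟨𝒫_j(Y_j), B_k(c₁), …, B_k(c_n)⟩` at the
CONCRETE `Ū_k^j = B7Prop2Explicit.avgIter L U j` (`evalSize`; admissible `Y_j` only, `|c_{i,−} − y|₁ ≤ D` with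
`D·4L²B₃ε(L^jη)² ≤ ½`) satisfy
* (44) `Bound44` whenever `U_k` has the p. 267 regularity (`bound44_concrete`; `G = U(N)`: `bound44_unitaryGroup`) —
  `bound44_of_shape43` with its two inputs DISCHARGED: the loop-variable bound by `B10Eq44AvgRegularity.loop44_le`,
  the multilinear bound `|⟨𝒫, B₁, …, B_n⟩| ≤ |𝒫| Π|B_i|` by Mathlib's `ContinuousMultilinearMap.le_opNorm`;
* (45) `Bound45` for the block sums `Σ_{Y_j: y = y₀}` over any finite sets of admissible bonds and every degree cut-off,
  with r07's constants `CM = 8L²B₃·3(2M₁/κ₁)(1 + 4M₁/κ₁)³`, `O(1) = 2C` (`bound45_concrete`, `bound45_unitaryGroup`) —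
  `bound45_latticeGeometry3` with (44) and the degree floor (`evalSize_floor`, from (43)'s `n ≥ 2`) DISCHARGED;
* v1.1 (append-only, same seat): (46) *"Summation over `y` gives the factor `(M₁L^jη)^{−3}|Λ_k|`, and finally summation
  over `j = 1, …, k` gives … `Σ_{j=1}^k Σ_{Y_j} |𝒫_j(Y_j, U_k)| ≤ O(1)M₁³g²_{k−1}p²(g_{k−1})|Λ_k|`. (46)"* for the
  concrete average: `bound46_concrete` — r07's `bound46_of_bound45` (d = 3 power counting `B10.powerCounting_d3`) fed
  with `bound45_concrete` at every scale `j = 1, …, k` (coefficients `𝒫_j`, radii `D_j`, admissible sets and the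
  printed block count `#(blocks j) ≤ (M₁L^jη)^{−3}|Λ_k|` per scale; hypotheses: (43) at every scale and the p. 267
  regularity of `U_k`).
MODEL NOTES.  (M1)–(M5) of `B10Eq44AvgRegularity` apply (lattices on `ℤ^d`, here `d = 3` as printed; `U_k` any
configuration with the printed regularity on all of `ηℤ³`; explicit smallness; `AvgClosed` gauge groups incl. `U(N)`;
`ℓ¹` distances — `cast_l1_eq_l1dist` identifies b07's `ℕ`-valued length with r07's real `l1dist`).  (M6) The
coefficients `𝒫_j(Y_j)` are modelled as continuous `ℂ`-multilinear forms on `𝔸ⁿ` (`Coef`), `|𝒫_j(Y_j)|` = operator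
norm (`coefSize`); the family of terms is indexed by the ADMISSIBLE `Y_j` of (43) — `evalSize` is `0` off the
admissible index tuples (no term there), so `Bound44` (quantified over all index tuples) is the printed (44).  (M7) The
tree-length datum `tl` of `VertexGeometry` ((56)) is not used by (43)–(45).  No `sorry`; axioms `propext`,
`Classical.choice`, `Quot.sound`; no new named facts (`Coef`, `coefSize`, `Adm`, `evalSize` are carriers with bodies).
-/

noncomputable section

open scoped BigOperators
open NormedSpace Finset

namespace Literature.MathematicalPhysics.QuantumFieldTheory.Balaban1983to89.B10Eq44Concrete

open B7Prop1Explicit B7Prop2Explicit B10Eq44AvgRegularity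
open B10Eq27AxialLog (B27)
open B10SectCExpansion (VertexGeometry TermSizes Shape43 Bound44 Bound45 blockSum45 bound44_of_shape43
  bound46_of_bound45)
open B10Eq45LatticeSum (l1dist l1dist_nonneg latticeGeometry3 bound45_latticeGeometry3)

export B7Prop1Explicit (Site) -- the `ℤ^d` sites (the torus `Site` of `Setup.lean` would shadow them)

/-! ## §1 Carriers: coefficients (43), admissible `Y_j`, evaluated term sizes on `latticeGeometry3` -/

/-- `0 < L^jη = L^j(L^k)⁻¹` for `L ≥ 2`. [folklore] -/
private theorem scale_pos {L : ℕ} (hL : 2 ≤ L) (j k : ℕ) : 0 < (L : ℝ) ^ j * ((L : ℝ) ^ k)⁻¹ := by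
  have hLr : (2 : ℝ) ≤ L := by exact_mod_cast hL
  have hL0 : (0 : ℝ) < L := by linarith
  positivity

/-- b07's `ℕ`-valued `ℓ¹` length `|x − y|₁` (`B7Prop1Explicit.l1`, the length of the tree contour `Γ_{y,x}`) is r07's
real `ℓ¹` lattice distance `B10Eq45LatticeSum.l1dist x y` of (43)–(45). [cite: Balaban1985UV3, (43) p.266] -/
theorem cast_l1_eq_l1dist (x y : Site 3) : (l1 (x - y) : ℝ) = l1dist x y := by
  simp only [l1, l1dist, Nat.cast_sum, Pi.sub_apply, Nat.cast_natAbs, Int.cast_abs, Int.cast_sub]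

section Carriers

variable {𝔸 : Type} [NormedRing 𝔸] [NormedAlgebra ℂ 𝔸]

variable (𝔸) in
/-- The coefficients `𝒫_j(Y_j)`, `Y_j = (y, c₁, …, c_n)`, of (43), modelled as continuous multilinear forms on `𝔸ⁿ`
(the term is `𝒫_j(Y_j, U_k) = ⟨𝒫_j(Y_j), B_k(c₁), …, B_k(c_n)⟩` — MODEL NOTE (M6)); bonds `c = (c₋, μ)` of
`Ω_k^{(j)} ≅ ℤ³`. [cite: Balaban1985UV3, (43) p.266] -/
abbrev Coef : Type :=
  (y : Site 3) → (n : ℕ) → (Fin n → Site 3 × Fin 3) → ContinuousMultilinearMap ℂ (fun _ : Fin n => 𝔸) ℂ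

/-- `|𝒫_j(Y_j)|` = the operator norm of the multilinear coefficient — the `TermSizes` of (43) on `latticeGeometry3 ℓ tl`
(for every spacing `ℓ` and tree-length datum `tl`: the type `TermSizes (latticeGeometry3 ℓ tl)` unfolds to this one).
[cite: Balaban1985UV3, (43) p.266] -/
def coefSize (P : Coef 𝔸) : Site 3 → (n : ℕ) → (Fin n → Site 3 × Fin 3) → ℝ := fun y n c => ‖P y n c‖

/-- Admissible `Y_j = (y, c₁, …, c_n)`: every `|c_{i,−} − y|₁ ≤ D` ((43): *"`|c_{i,−} − y| < R(g_j)M₁L^jη`"*, `D` the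
radius in `L^jη`-units). [cite: Balaban1985UV3, (43) p.266] -/
def Adm (D : ℕ) (y : Site 3) {n : ℕ} (c : Fin n → Site 3 × Fin 3) : Prop := ∀ i, l1 ((c i).1 - y) ≤ D

open scoped Classical in
/-- `|𝒫_j(Y_j, U_k)| = |⟨𝒫_j(Y_j), B_k(c₁), …, B_k(c_n)⟩|`, the evaluated interaction term (43) at a configuration `W`
of `Ω_k^{(j)}` (`W = Ū_k^j`; `B_k(c) = B10Eq27AxialLog.B27 W y c₋ μ` = `(1/i) log W(Γ_{y,c₋} ∪ c ∪ Γ_{c₊,y})`), for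
admissible `Y_j`, and `0` for the non-admissible index tuples (no term). [cite: Balaban1985UV3, (43) p.266, (44) p.267] -/
def evalSize (P : Coef 𝔸) (D : ℕ) (W : Site 3 → Fin 3 → 𝔸ˣ) :
    Site 3 → (n : ℕ) → (Fin n → Site 3 × Fin 3) → ℝ := fun y n c =>
  if Adm D y c then ‖P y n c fun i => B27 W y (c i).1 (c i).2‖ else 0

/-- The degree floor of (43) (*"`n ≥ 2`"*, the first clause of `Shape43`) passes to the evaluated terms: a nonzero
`𝒫_j(Y_j, U_k)` has `n ≥ 2`. [cite: Balaban1985UV3, (43) p.266, (45) p.267] -/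
theorem evalSize_floor {ℓ : ℝ} {tl : Set (Site 3 × Fin 3) → Set (Site 3) → ℝ} (P : Coef 𝔸) (D : ℕ)
    (W : Site 3 → Fin 3 → 𝔸ˣ) {κ₁ M₁ C : ℝ} (h43 : Shape43 (latticeGeometry3 ℓ tl) (coefSize P) κ₁ M₁ ℓ C)
    (y : Site 3) (n : ℕ) (c : Fin n → Site 3 × Fin 3) (hne : evalSize P D W y n c ≠ 0) : 2 ≤ n := by
  classical
  refine h43.1 y n c fun hP => hne ?_
  have hP0 : P y n c = 0 := norm_eq_zero.mp hP
  simp [evalSize, hP0]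

end Carriers

/-! ## §2 (44) for the concrete average, derived from (43) and the p. 267 regularity of `U_k` -/

section Bound44

variable {𝔸 : Type} [NormedRing 𝔸] [NormOneClass 𝔸] [NormedAlgebra ℂ 𝔸] [CompleteSpace 𝔸]

/-- **(44) p. 267 for the concrete average, DERIVED from (43):** `U_k` a `G`-valued configuration on `ηℤ³`
(`G` `AvgClosed`, e.g. `U(N)`) with the p. 267 regularity `|U_k(∂p) − 1| < 2L²B₃g p η²` and [4] Prop. 2's smallness
for `α₀ = 2L²B₃g p`; `j ≤ k`, `ℓ = L^jη`; coefficients `𝒫_j(Y_j)` obeying (43) with constants `O(1) = C ≥ 0`, `κ₁`,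
`M₁` (`Shape43`, hypothesis as printed); admissibility radius `D` with `D·4L²B₃g p ℓ² ≤ ½` (*"for `g_{k−1}` sufficiently
small"*).  THEN the evaluated terms `|𝒫_j(Y_j, U_k)| = |⟨𝒫_j(Y_j), B_k(c₁), …, B_k(c_n)⟩|`, `B_k(c) = (1/i) log
Ū_k^j(Γ_{y,c₋} ∪ c ∪ Γ_{c₊,y})`, satisfy (44): `≤ C Π_i exp(−κ₁(M₁ℓ)^{−1}|c_{i,−} − y|)·(ℓ^{−1}|c_{i,−} − y|·8L²B₃g p
ℓ²)` — r07's `bound44_of_shape43` with the loop bound supplied by `B10Eq44AvgRegularity.loop44_le` and the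
multilinear bound by `ContinuousMultilinearMap.le_opNorm`. [cite: Balaban1985UV3, (44) p.267] -/
theorem bound44_concrete (L : ℕ) (hL : 2 ≤ L) {G : Subgroup 𝔸ˣ} (hG : AvgClosed 3 L G) (k : ℕ)
    (U : Site 3 → Fin 3 → 𝔸ˣ) (hU : ∀ x κ, U x κ ∈ G) {B₃ g pg : ℝ} (hpos : 0 < (L : ℝ) ^ 2 * B₃ * (g * pg))
    (hα3 : C0 3 * (2 * (L : ℝ) ^ 2 * B₃ * (g * pg)) ≤ 1 / 3)
    (hα2 : 2 * (2 * (L : ℝ) ^ 2 * B₃ * (g * pg)) ≤ c2' 3 L)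
    (hreg : pdev U < 2 * (L : ℝ) ^ 2 * B₃ * (g * pg) * (((L : ℝ) ^ k)⁻¹) ^ 2) {j : ℕ} (hj : j ≤ k)
    (tl : Set (Site 3 × Fin 3) → Set (Site 3) → ℝ) (P : Coef 𝔸) {κ₁ M₁ C : ℝ} (hC : 0 ≤ C)
    (h43 : Shape43 (latticeGeometry3 ((L : ℝ) ^ j * ((L : ℝ) ^ k)⁻¹) tl) (coefSize P) κ₁ M₁
      ((L : ℝ) ^ j * ((L : ℝ) ^ k)⁻¹) C)
    {D : ℕ} (hD : (D : ℝ) * (4 * (L : ℝ) ^ 2 * B₃ * (g * pg) * ((L : ℝ) ^ j * ((L : ℝ) ^ k)⁻¹) ^ 2) ≤ 1 / 2) :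
    Bound44 (latticeGeometry3 ((L : ℝ) ^ j * ((L : ℝ) ^ k)⁻¹) tl) (evalSize P D (avgIter L U j)) κ₁ M₁
      ((L : ℝ) ^ j * ((L : ℝ) ^ k)⁻¹) (L : ℝ) B₃ g pg C := by
  classical
  have hℓ0 := scale_pos hL j k
  set ℓ : ℝ := (L : ℝ) ^ j * ((L : ℝ) ^ k)⁻¹ with hℓ
  have hfac : 0 ≤ 8 * (L : ℝ) ^ 2 * B₃ * g * pg * ℓ ^ 2 := by
    have h := mul_pos hpos (pow_pos hℓ0 2)
    linarith
  have hfac4 : 0 ≤ 4 * (L : ℝ) ^ 2 * B₃ * (g * pg) * ℓ ^ 2 := by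
    have h := mul_pos hpos (pow_pos hℓ0 2)
    linarith
  -- the loop sizes `|B_k(c)|`, cut off at the admissibility radius
  let loop : Site 3 → Site 3 × Fin 3 → ℝ := fun y b =>
    if l1 (b.1 - y) ≤ D then ‖B27 (avgIter L U j) y b.1 b.2‖ else 0
  have hloop_nonneg : ∀ y b, 0 ≤ loop y b := fun y b => by
    simp only [loop]; split_ifs
    · exact norm_nonneg _
    · exact le_rfl
  have hloop_in : ∀ (y : Site 3) (b : Site 3 × Fin 3), l1 (b.1 - y) ≤ D →
      ‖B27 (avgIter L U j) y b.1 b.2‖ ≤ (l1 (b.1 - y) : ℝ) * (8 * (L : ℝ) ^ 2 * B₃ * (g * pg) * ℓ ^ 2) := by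
    intro y b hb
    refine loop44_le L hL hG k U hU hpos hα3 hα2 hreg hj y b.1 b.2 ?_
    have hbD : (l1 (b.1 - y) : ℝ) ≤ D := by exact_mod_cast hb
    exact (mul_le_mul_of_nonneg_right hbD hfac4).trans hD
  refine bound44_of_shape43 (latticeGeometry3 ℓ tl) (coefSize P) (evalSize P D (avgIter L U j)) loop hC h43
    hloop_nonneg (fun (y : Site 3) (b : Site 3 × Fin 3) => ?_)
    (fun (y : Site 3) (n : ℕ) (c : Fin n → Site 3 × Fin 3) => ?_)
  · -- the loop-variable bound of (44)
    have hdist : ℓ⁻¹ * (ℓ * l1dist b.1 y) = (l1 (b.1 - y) : ℝ) := by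
      rw [← mul_assoc, inv_mul_cancel₀ hℓ0.ne', one_mul, cast_l1_eq_l1dist]
    show loop y b ≤ (ℓ⁻¹ * (ℓ * l1dist b.1 y)) * (8 * (L : ℝ) ^ 2 * B₃ * g * pg * ℓ ^ 2)
    rw [hdist]
    simp only [loop]
    split_ifs with hb
    · have h := hloop_in y b hb
      convert h using 1; ring
    · exact mul_nonneg (Nat.cast_nonneg _) hfac
  · -- the multilinear bound `|⟨𝒫, B₁, …, B_n⟩| ≤ |𝒫| Π |B_i|`
    simp only [evalSize, coefSize]
    split_ifs with hadm
    · rw [abs_of_nonneg (norm_nonneg _), abs_of_nonneg (norm_nonneg _)]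
      refine (ContinuousMultilinearMap.le_opNorm _ _).trans (le_of_eq ?_)
      congr 1
      refine Finset.prod_congr rfl fun i _ => ?_
      simp only [loop, if_pos (hadm i)]
    · rw [abs_zero]
      exact mul_nonneg (abs_nonneg _) (Finset.prod_nonneg fun i _ => hloop_nonneg y (c i))

/-- **(45) p. 267 for the concrete average:** under the hypotheses of `bound44_concrete`, for every family `adm y₀` of
finite sets of bonds (print: the admissible `|c₋ − y₀| < R(g_j)M₁L^jη`), every degree cut-off `N`, `κ₁, M₁ > 0`,
`B₃, g, p ≥ 0` and the one smallness `8L²B₃·Z₃·g p·ℓ² ≤ ½`, `Z₃ = 3(2M₁/κ₁)(1 + 4M₁/κ₁)³`, the block sums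
`Σ_{Y_j: y = y₀} |𝒫_j(Y_j, U_k)|` of the evaluated terms at the concrete `Ū_k^j` satisfy (45) in the typed shape
`Bound45` with `CM = 8L²B₃Z₃`, `O(1) = 2C`: r07's `B10Eq45LatticeSum.bound45_latticeGeometry3` with (44)
(`bound44_concrete`) and the degree floor (`evalSize_floor`) DISCHARGED. [cite: Balaban1985UV3, (45) p.267] -/
theorem bound45_concrete (L : ℕ) (hL : 2 ≤ L) {G : Subgroup 𝔸ˣ} (hG : AvgClosed 3 L G) (k : ℕ)
    (U : Site 3 → Fin 3 → 𝔸ˣ) (hU : ∀ x κ, U x κ ∈ G) {B₃ g pg : ℝ} (hB : 0 ≤ B₃) (hg : 0 ≤ g) (hpg : 0 ≤ pg)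
    (hpos : 0 < (L : ℝ) ^ 2 * B₃ * (g * pg)) (hα3 : C0 3 * (2 * (L : ℝ) ^ 2 * B₃ * (g * pg)) ≤ 1 / 3)
    (hα2 : 2 * (2 * (L : ℝ) ^ 2 * B₃ * (g * pg)) ≤ c2' 3 L)
    (hreg : pdev U < 2 * (L : ℝ) ^ 2 * B₃ * (g * pg) * (((L : ℝ) ^ k)⁻¹) ^ 2) {j : ℕ} (hj : j ≤ k)
    (tl : Set (Site 3 × Fin 3) → Set (Site 3) → ℝ) (P : Coef 𝔸) {κ₁ M₁ C : ℝ} (hκ : 0 < κ₁) (hM : 0 < M₁)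
    (hC : 0 ≤ C)
    (h43 : Shape43 (latticeGeometry3 ((L : ℝ) ^ j * ((L : ℝ) ^ k)⁻¹) tl) (coefSize P) κ₁ M₁
      ((L : ℝ) ^ j * ((L : ℝ) ^ k)⁻¹) C)
    {D : ℕ} (hD : (D : ℝ) * (4 * (L : ℝ) ^ 2 * B₃ * (g * pg) * ((L : ℝ) ^ j * ((L : ℝ) ^ k)⁻¹) ^ 2) ≤ 1 / 2)
    (adm : Site 3 → Finset (Site 3 × Fin 3)) (N : ℕ)
    (hsmall : 8 * (L : ℝ) ^ 2 * B₃ * (3 * ((2 * M₁ / κ₁) * (1 + 4 * M₁ / κ₁) ^ 3)) * g * pg *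
      ((L : ℝ) ^ j * ((L : ℝ) ^ k)⁻¹) ^ 2 ≤ 1 / 2) :
    Bound45 (latticeGeometry3 ((L : ℝ) ^ j * ((L : ℝ) ^ k)⁻¹) tl)
      (blockSum45 (latticeGeometry3 ((L : ℝ) ^ j * ((L : ℝ) ^ k)⁻¹) tl) (evalSize P D (avgIter L U j)) adm N)
      (8 * (L : ℝ) ^ 2 * B₃ * (3 * ((2 * M₁ / κ₁) * (1 + 4 * M₁ / κ₁) ^ 3))) g pg
      ((L : ℝ) ^ j * ((L : ℝ) ^ k)⁻¹) (2 * C) :=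
  bound45_latticeGeometry3 hκ hM (scale_pos hL j k) hC hB hg hpg tl (evalSize P D (avgIter L U j)) adm N
    (bound44_concrete L hL hG k U hU hpos hα3 hα2 hreg hj tl P hC h43 hD)
    (evalSize_floor P D (avgIter L U j) h43) hsmall

end Bound44

/-! ## §4 (46): the sum of all interaction terms in (41), for the concrete average -/

section Bound46

variable {𝔸 : Type} [NormedRing 𝔸] [NormOneClass 𝔸] [NormedAlgebra ℂ 𝔸] [CompleteSpace 𝔸]

/-- `L^jη = L^j(L^k)⁻¹ = (L⁻¹)^{k−j}` for `j ≤ k` (the form of the scales in r07's `bound46_of_bound45`). [folklore] -/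
private theorem scale_eq_inv_pow {L : ℕ} (hL : 2 ≤ L) {j k : ℕ} (hj : j ≤ k) :
    (L : ℝ) ^ j * ((L : ℝ) ^ k)⁻¹ = (L : ℝ)⁻¹ ^ (k - j) := by
  have hL0 : (L : ℝ) ≠ 0 := by
    have : (2 : ℝ) ≤ L := by exact_mod_cast hL
    positivity
  rw [inv_pow, pow_sub₀ _ hL0 hj, mul_inv, inv_inv, mul_comm]

/-- **(46) p. 267 for the concrete average** (*"Summation over `y` gives the factor `(M₁L^jη)^{−3}|Λ_k|`, and finally
summation over `j = 1, …, k` gives the following bound for the sum of interaction terms in (41), `Σ_{j=1}^k Σ_{Y_j}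
|𝒫_j(Y_j, U_k)| ≤ O(1)M₁³g²_{k−1}p²(g_{k−1})|Λ_k|`. (46)"*): `U_k` with the p. 267 regularity (`G` `AvgClosed`); at
every scale `j = 1, …, k` coefficients `𝒫_j(Y_j)` obeying (43) with the same constants `C, κ₁, M₁`, admissibility
radii `D_j` and the two smallness conditions of `bound45_concrete`, finite sets `blocks j` of big blocks with the
printed count `#(blocks j) ≤ (M₁L^jη)^{−3}|Λ_k|`; THEN the double sum of the evaluated block sums is
`≤ 2C·CM²·M₁^{−3}·(L/(L − 1))·(g p)²·|Λ_k|`, `CM = 8L²B₃·3(2M₁/κ₁)(1 + 4M₁/κ₁)³` — r07's `bound46_of_bound45` (with the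
`d = 3` power counting `B10.powerCounting_d3`) fed with `bound45_concrete` at every scale; in print's letters
`O(1)M₁³g²p²|Λ_k|` (`B10SectCExpansion.bound46_printed_shape`). [cite: Balaban1985UV3, (46) p.267] -/
theorem bound46_concrete (L : ℕ) (hL : 2 ≤ L) {G : Subgroup 𝔸ˣ} (hG : AvgClosed 3 L G) (k : ℕ)
    (U : Site 3 → Fin 3 → 𝔸ˣ) (hU : ∀ x κ, U x κ ∈ G) {B₃ g pg : ℝ} (hB : 0 ≤ B₃) (hg : 0 ≤ g) (hpg : 0 ≤ pg)
    (hpos : 0 < (L : ℝ) ^ 2 * B₃ * (g * pg)) (hα3 : C0 3 * (2 * (L : ℝ) ^ 2 * B₃ * (g * pg)) ≤ 1 / 3)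
    (hα2 : 2 * (2 * (L : ℝ) ^ 2 * B₃ * (g * pg)) ≤ c2' 3 L)
    (hreg : pdev U < 2 * (L : ℝ) ^ 2 * B₃ * (g * pg) * (((L : ℝ) ^ k)⁻¹) ^ 2)
    (tl : ℕ → Set (Site 3 × Fin 3) → Set (Site 3) → ℝ) (P : ℕ → Coef 𝔸) {κ₁ M₁ C : ℝ} (hκ : 0 < κ₁)
    (hM : 0 < M₁) (hC : 0 ≤ C)
    (h43 : ∀ j ∈ Finset.Icc 1 k, Shape43 (latticeGeometry3 ((L : ℝ) ^ j * ((L : ℝ) ^ k)⁻¹) (tl j))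
      (coefSize (P j)) κ₁ M₁ ((L : ℝ) ^ j * ((L : ℝ) ^ k)⁻¹) C)
    (D : ℕ → ℕ) (hD : ∀ j ∈ Finset.Icc 1 k,
      (D j : ℝ) * (4 * (L : ℝ) ^ 2 * B₃ * (g * pg) * ((L : ℝ) ^ j * ((L : ℝ) ^ k)⁻¹) ^ 2) ≤ 1 / 2)
    (adm : ℕ → Site 3 → Finset (Site 3 × Fin 3)) (N : ℕ → ℕ)
    (hsmall : ∀ j ∈ Finset.Icc 1 k, 8 * (L : ℝ) ^ 2 * B₃ * (3 * ((2 * M₁ / κ₁) * (1 + 4 * M₁ / κ₁) ^ 3)) * g * pg *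
      ((L : ℝ) ^ j * ((L : ℝ) ^ k)⁻¹) ^ 2 ≤ 1 / 2)
    (blocks : ℕ → Finset (Site 3)) {Λvol : ℝ} (hΛ : 0 ≤ Λvol)
    (hcard : ∀ j ∈ Finset.Icc 1 k,
      ((blocks j).card : ℝ) ≤ (M₁ * ((L : ℝ) ^ j * ((L : ℝ) ^ k)⁻¹))⁻¹ ^ 3 * Λvol) :
    ∑ j ∈ Finset.Icc 1 k, ∑ y ∈ blocks j,
        blockSum45 (latticeGeometry3 ((L : ℝ) ^ j * ((L : ℝ) ^ k)⁻¹) (tl j))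
          (evalSize (P j) (D j) (avgIter L U j)) (adm j) (N j) y ≤
      2 * C * (8 * (L : ℝ) ^ 2 * B₃ * (3 * ((2 * M₁ / κ₁) * (1 + 4 * M₁ / κ₁) ^ 3))) ^ 2 * M₁⁻¹ ^ 3 *
        ((L : ℝ) / ((L : ℝ) - 1)) * (g * pg) ^ 2 * Λvol := by
  have hLr : (1 : ℝ) < L := by exact_mod_cast lt_of_lt_of_le (by norm_num) hL
  have h := bound46_of_bound45 (latticeGeometry3 1 (tl 0)) k blocks
    (fun j y => blockSum45 (latticeGeometry3 ((L : ℝ) ^ j * ((L : ℝ) ^ k)⁻¹) (tl j))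
      (evalSize (P j) (D j) (avgIter L U j)) (adm j) (N j) y)
    (fun j => (L : ℝ) ^ j * ((L : ℝ) ^ k)⁻¹) hLr hM (by positivity : (0 : ℝ) ≤ 2 * C) hΛ
    (fun j hj => scale_eq_inv_pow hL (Finset.mem_Icc.mp hj).2)
    (fun j hj => bound45_concrete L hL hG k U hU hB hg hpg hpos hα3 hα2 hreg (Finset.mem_Icc.mp hj).2 (tl j) (P j)
      hκ hM hC (h43 j hj) (hD j hj) (adm j) (N j) (hsmall j hj))
    hcard
  exact h

end Bound46

/-! ## §3 The paper's setting `G = U(N) ⊂ M_N(ℂ)`, operator norm -/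

section Matrices

open scoped Matrix.Norms.L2Operator

/-- **(44) p. 267 for `G = U(N) ⊂ M_N(ℂ)`, `N ≥ 1`, operator norm (19) of [4]** — `bound44_concrete` in the paper's
setting. [cite: Balaban1985UV3, (44) p.267] -/
theorem bound44_unitaryGroup (N : ℕ) [NeZero N] (L : ℕ) (hL : 2 ≤ L) (k : ℕ)
    (U : Site 3 → Fin 3 → (Matrix (Fin N) (Fin N) ℂ)ˣ)
    (hU : ∀ x κ, U x κ ∈ unitaryUnits (Matrix (Fin N) (Fin N) ℂ)) {B₃ g pg : ℝ}
    (hpos : 0 < (L : ℝ) ^ 2 * B₃ * (g * pg)) (hα3 : C0 3 * (2 * (L : ℝ) ^ 2 * B₃ * (g * pg)) ≤ 1 / 3)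
    (hα2 : 2 * (2 * (L : ℝ) ^ 2 * B₃ * (g * pg)) ≤ c2' 3 L)
    (hreg : pdev U < 2 * (L : ℝ) ^ 2 * B₃ * (g * pg) * (((L : ℝ) ^ k)⁻¹) ^ 2) {j : ℕ} (hj : j ≤ k)
    (tl : Set (Site 3 × Fin 3) → Set (Site 3) → ℝ) (P : Coef (Matrix (Fin N) (Fin N) ℂ)) {κ₁ M₁ C : ℝ}
    (hC : 0 ≤ C)
    (h43 : Shape43 (latticeGeometry3 ((L : ℝ) ^ j * ((L : ℝ) ^ k)⁻¹) tl) (coefSize P) κ₁ M₁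
      ((L : ℝ) ^ j * ((L : ℝ) ^ k)⁻¹) C)
    {D : ℕ} (hD : (D : ℝ) * (4 * (L : ℝ) ^ 2 * B₃ * (g * pg) * ((L : ℝ) ^ j * ((L : ℝ) ^ k)⁻¹) ^ 2) ≤ 1 / 2) :
    Bound44 (latticeGeometry3 ((L : ℝ) ^ j * ((L : ℝ) ^ k)⁻¹) tl) (evalSize P D (avgIter L U j)) κ₁ M₁
      ((L : ℝ) ^ j * ((L : ℝ) ^ k)⁻¹) (L : ℝ) B₃ g pg C := by
  letI : CStarAlgebra (Matrix (Fin N) (Fin N) ℂ) := {}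
  exact bound44_concrete L hL (avgClosed_unitaryUnits 3 L) k U hU hpos hα3 hα2 hreg hj tl P hC h43 hD

/-- **(45) p. 267 for `G = U(N) ⊂ M_N(ℂ)`, `N ≥ 1`, operator norm** — `bound45_concrete` in the paper's setting.
[cite: Balaban1985UV3, (45) p.267] -/
theorem bound45_unitaryGroup (N : ℕ) [NeZero N] (L : ℕ) (hL : 2 ≤ L) (k : ℕ)
    (U : Site 3 → Fin 3 → (Matrix (Fin N) (Fin N) ℂ)ˣ)
    (hU : ∀ x κ, U x κ ∈ unitaryUnits (Matrix (Fin N) (Fin N) ℂ)) {B₃ g pg : ℝ} (hB : 0 ≤ B₃) (hg : 0 ≤ g)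
    (hpg : 0 ≤ pg) (hpos : 0 < (L : ℝ) ^ 2 * B₃ * (g * pg))
    (hα3 : C0 3 * (2 * (L : ℝ) ^ 2 * B₃ * (g * pg)) ≤ 1 / 3) (hα2 : 2 * (2 * (L : ℝ) ^ 2 * B₃ * (g * pg)) ≤ c2' 3 L)
    (hreg : pdev U < 2 * (L : ℝ) ^ 2 * B₃ * (g * pg) * (((L : ℝ) ^ k)⁻¹) ^ 2) {j : ℕ} (hj : j ≤ k)
    (tl : Set (Site 3 × Fin 3) → Set (Site 3) → ℝ) (P : Coef (Matrix (Fin N) (Fin N) ℂ)) {κ₁ M₁ C : ℝ}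
    (hκ : 0 < κ₁) (hM : 0 < M₁) (hC : 0 ≤ C)
    (h43 : Shape43 (latticeGeometry3 ((L : ℝ) ^ j * ((L : ℝ) ^ k)⁻¹) tl) (coefSize P) κ₁ M₁
      ((L : ℝ) ^ j * ((L : ℝ) ^ k)⁻¹) C)
    {D : ℕ} (hD : (D : ℝ) * (4 * (L : ℝ) ^ 2 * B₃ * (g * pg) * ((L : ℝ) ^ j * ((L : ℝ) ^ k)⁻¹) ^ 2) ≤ 1 / 2)
    (adm : Site 3 → Finset (Site 3 × Fin 3)) (N' : ℕ)
    (hsmall : 8 * (L : ℝ) ^ 2 * B₃ * (3 * ((2 * M₁ / κ₁) * (1 + 4 * M₁ / κ₁) ^ 3)) * g * pg *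
      ((L : ℝ) ^ j * ((L : ℝ) ^ k)⁻¹) ^ 2 ≤ 1 / 2) :
    Bound45 (latticeGeometry3 ((L : ℝ) ^ j * ((L : ℝ) ^ k)⁻¹) tl)
      (blockSum45 (latticeGeometry3 ((L : ℝ) ^ j * ((L : ℝ) ^ k)⁻¹) tl) (evalSize P D (avgIter L U j)) adm N')
      (8 * (L : ℝ) ^ 2 * B₃ * (3 * ((2 * M₁ / κ₁) * (1 + 4 * M₁ / κ₁) ^ 3))) g pg
      ((L : ℝ) ^ j * ((L : ℝ) ^ k)⁻¹) (2 * C) := by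
  letI : CStarAlgebra (Matrix (Fin N) (Fin N) ℂ) := {}
  exact bound45_concrete L hL (avgClosed_unitaryUnits 3 L) k U hU hB hg hpg hpos hα3 hα2 hreg hj tl P hκ hM hC h43
    hD adm N' hsmall

end Matrices

end Literature.MathematicalPhysics.QuantumFieldTheory.Balaban1983to89.B10Eq44Concrete

end
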